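import Literature.AlgebraicGeometry.AbelianSchemes.KOfLKilledByInvertibleExponentOnStage
import Literature.AlgebraicGeometry.AbelianSchemes.GraphPointLevelZero
import Literature.AlgebraicGeometry.AbelianSchemes.MumfordQuotientConstruction
import HarnessLib

/-!
# `K(L)` is killed by ONE exponent on all base changes of FINITELY MANY affine charts on which that exponent is invertible
# (Mumford, *Abelian Varieties* §13 «`K(L) ⊆ X[n]`»; the finite-cover form of ★ «KL-STAGE»)

Layer `Literature/AlgebraicGeometry/AbelianSchemes`, namespace `Literature.AlgebraicGeometry.AbelianSchemes.AbelianSchemeOver`.  THEOREMS ONLY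
(no definition, no named fact, no instance, no notation, no `sorry`).  Cell `hodgecm-mathlib` (D-0151), P6 «MOD programme», L4 DUALS road, organ
**(O4-δ)** of the stage Mumford-bundle package (LEAD F0P6-plan (g3) «M-55c»; LA4-p05 (g0)): the binders `hn : IsUnit (n : R)` and
`hkill : ∀ T u, A.MemKOfL L u → u ^ n = 1` of the re-typed socket `stub_DUALS : DualPairOfAmpleRigidified` on the affine charts of a shrunken stage.
HC_CM is proved only modulo the printed citations (2 remaining named inputs hLiu418 24832, h413 24833) until rung 0 closes; count-neutral.

★ «KL-STAGE» `exists_nat_isUnit_pow_eq_one_of_memKOfL` (B-p02 (g22)) treats ONE affine base `Spec R` (`R` Noetherian of characteristic `0`):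
`∃ d n, n ∣ d`, and on every `Spec R′ → Spec R` with `d ∈ R′^×` every base change `A′` of `A` has `K(G^*L)` killed by `n`.  The stage base of the
chain is NOT affine: it is a quasi-compact Noetherian scheme covered by finitely many affine charts `cᵢ : Spec Rᵢ → S`.  This file runs ★ KL-STAGE
on every chart of a FINITE family (rigidification and fibrewise-ample class base-change for free: ★ `pullback_unitSection_detClass_baseChange_eq_one`,
★ `exists_isAmple_cechClass_fibre_baseChange`) and takes `d := ∏ dᵢ` as the COMMON exponent (each `nᵢ ∣ dᵢ ∣ d`, so `uⁿⁱ = 1 ⇒ uᵈ = 1`, and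
`d ∈ R′^× ⇒ dᵢ ∈ R′^×`, ★ `isUnit_natCast_of_dvd`):

* (private) `pow_eq_one_of_pow_eq_one_of_dvd` — `u ^ n = 1`, `n ∣ d ⇒ u ^ d = 1` for `T`-points of a group scheme;
* **`exists_nat_forall_chart_pow_eq_one_of_memKOfL`** — THE HEAD: `∃ d > 0, ∀ i R′ (φ : Rᵢ →+* R′), IsUnit (d : R′) → ∀ A′ G,
  A′.IsBaseChangeVia (𝒜.baseChange (c i)) (Spec.map φ) G → ∀ T u, A′.MemKOfL (G^*(L|ᵢ)) u → u ^ d = 1` (with `IsUnit (d : R′)` itself as `hn`).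

The consumer (chain step (4)) shrinks the stage `s ↦ s · d`; every affine chart of the finer stage base over a chart `Spec Rᵢ` of the coarser
one is such a `Spec R′` (the transition `D(s·d) → D(s)` is affine), so the letter's `hn`∕`hkill` hold there with `n := d`.

## References
* [MumfordAV1970] D. Mumford, *Abelian Varieties* (1970), §13 (p. 123) («`K(L)` is finite», «`K(L) ⊆ X[n]`»), §6 Application 3 (p. 64).
* [GortzWedhorn2023] U. Görtz, T. Wedhorn, *Algebraic Geometry II* (2023), Prop. 27.86 (p. 633), Prop. 27.187, Cor. 27.63, (27.1.1).
* [MumfordFogartyKirwan1994] D. Mumford, J. Fogarty, F. Kirwan, *GIT*, 3rd ed. (1994), Ch. 6 §2 Prop. 6.13 (iii) (p. 123).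
-/

set_option autoImplicit false

noncomputable section

open CategoryTheory CategoryTheory.Limits AlgebraicGeometry MonoidalCategory CartesianMonoidalCategory
open scoped MonObj

namespace Literature.AlgebraicGeometry.AbelianSchemes

open Literature.AlgebraicGeometry.Motives Literature.AlgebraicGeometry.Modules

namespace AbelianSchemeOver

/-- `u ^ n = 1` and `n ∣ d` ⇒ `u ^ d = 1` (powers in the monoid of `T`-points of a group scheme). [folklore] -/
private theorem pow_eq_one_of_pow_eq_one_of_dvd {S : Scheme} (B : AbelianSchemeOver S) {T : Over S} (u : T ⟶ B.X) {n d : ℕ}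
    (hnd : n ∣ d) (hu : u ^ n = 1) : u ^ d = 1 := by
  obtain ⟨c, rfl⟩ := hnd
  rw [pow_mul, hu, one_pow]

/-- **`K(L)` IS KILLED BY ONE EXPONENT, INVERTIBLE WHERE INVERTED, ON ALL BASE CHANGES OF FINITELY MANY AFFINE CHARTS** ([MumfordAV1970] §13
«`K(L) ⊆ X[n]`», the finite-cover form of ★ KL-STAGE): `𝒜` an abelian scheme over ANY scheme `S`, `L` rank one on `A` rigidified along the unit
section (`hε`) and of the class of an ample divisor at every geometric point (`hΘ`), `cᵢ : Spec Rᵢ → S` finitely many morphisms from spectra of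
Noetherian rings of characteristic `0` (e.g. an affine cover of a quasi-compact stage base flat over `𝓞[1∕t]`).  THEN there is `d ≥ 1` such that for
every `i`, every ring map `φ : Rᵢ → R′` with `d ∈ R′^×` and every base change `G : A′ → A ×_S Spec Rᵢ` of group schemes along `Spec φ`: every
`T`-valued point of `K(G^*(L|_{A ×_S Spec Rᵢ}))` is `d`-torsion — the binders `hn`, `hkill` of `DualPairOfAmpleRigidified` with `n := d`.
[cite: MumfordAV1970, §13 (p. 123) and §6 Application 3 (p. 64)] [cite: GortzWedhorn2023, Prop. 27.86 (p. 633) and (27.1.1)]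
[cite: MumfordFogartyKirwan1994, Ch. 6 §2 Prop. 6.13 (iii) (p. 123)] -/
theorem exists_nat_forall_chart_pow_eq_one_of_memKOfL {S : Scheme.{0}} (𝒜 : AbelianSchemeOver S) {L : 𝒜.left.Modules} (hL : HasRank L 1)
    (hε : CechPic.pullback 𝒜.unitSection (detClass (HasRank.isFiniteLocallyFree' hL)) = 1)
    (hΘ : ∀ ⦃Ω : Type⦄ [Field Ω] [IsAlgClosed Ω] (s : Spec (.of Ω) ⟶ S),
      ∃ Θ : CartierDivisor (𝒜.fibre s).toAbelianVariety.X.left, Θ.IsAmple ∧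
        CechPic.pullback (X := (𝒜.fibre s).toAbelianVariety.X.left) (pullback.fst 𝒜.X.hom s)
          (detClass (HasRank.isFiniteLocallyFree' hL)) = Θ.cechClass)
    {J : Type} [Finite J] (R : J → Type) [∀ i, CommRing (R i)] [∀ i, IsNoetherianRing (R i)] [∀ i, CharZero (R i)]
    (c : ∀ i : J, Spec (.of (R i)) ⟶ S) :
    ∃ d : ℕ, 0 < d ∧
      ∀ (i : J) (R' : Type) [CommRing R'] (φ : R i →+* R'), IsUnit ((d : ℕ) : R') →
        ∀ (A' : AbelianSchemeOver (Spec (.of R'))) (G : A'.X.left ⟶ (𝒜.baseChange (c i)).X.left),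
          A'.IsBaseChangeVia (𝒜.baseChange (c i)) (Spec.map (CommRingCat.ofHom φ)) G →
            ∀ (T : Over (Spec (.of R'))) (u : T ⟶ A'.X),
              A'.MemKOfL ((Scheme.Modules.pullback G).obj
                ((Scheme.Modules.pullback (pullback.fst 𝒜.X.hom (c i))).obj L)) u → u ^ d = 1 := by
  classical
  -- KL-STAGE on every chart
  have key : ∀ i : J, ∃ d : ℕ, 0 < d ∧ ∃ n : ℕ, 0 < n ∧ n ∣ d ∧
      ∀ (R' : Type) [CommRing R'] (φ : R i →+* R'), IsUnit ((d : ℕ) : R') →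
        ∀ (A' : AbelianSchemeOver (Spec (.of R'))) (G : A'.X.left ⟶ (𝒜.baseChange (c i)).X.left),
          A'.IsBaseChangeVia (𝒜.baseChange (c i)) (Spec.map (CommRingCat.ofHom φ)) G →
            IsUnit ((n : ℕ) : R') ∧
              ∀ (T : Over (Spec (.of R'))) (u : T ⟶ A'.X),
                A'.MemKOfL ((Scheme.Modules.pullback G).obj
                  ((Scheme.Modules.pullback (pullback.fst 𝒜.X.hom (c i))).obj L)) u → u ^ n = 1 := fun i =>
    (𝒜.baseChange (c i)).exists_nat_isUnit_pow_eq_one_of_memKOfL (hasRank_pullback (pullback.fst 𝒜.X.hom (c i)) hL)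
      (𝒜.pullback_unitSection_detClass_baseChange_eq_one (c i) hL hε)
      (𝒜.exists_isAmple_cechClass_fibre_baseChange hL hΘ (c i) (hasRank_pullback (pullback.fst 𝒜.X.hom (c i)) hL))
  choose d hd n hn hnd hkill using key
  haveI : Fintype J := Fintype.ofFinite J
  refine ⟨∏ i, d i, Finset.prod_pos fun i _ => hd i, fun i R' _ φ hunit A' G hG T u hu => ?_⟩
  have hdi : d i ∣ ∏ j, d j := Finset.dvd_prod_of_mem d (Finset.mem_univ i)
  have hui : IsUnit ((d i : ℕ) : R') := isUnit_natCast_of_dvd hdi hunit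
  exact pow_eq_one_of_pow_eq_one_of_dvd A' u ((hnd i).trans hdi) ((hkill i R' φ hui A' G hG).2 T u hu)

end AbelianSchemeOver

end Literature.AlgebraicGeometry.AbelianSchemes

end
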